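import Summits.QuantumFields.YangMills.Theorems.BalabanUVNodesN21SourceTiltAtRecord
import Literature.MathematicalPhysics.QuantumFieldTheory.Balaban1983to89.T4GenFunConverse

/-!
# YM-DAG node N21 (= NE7c) — THE JOINT-SPACE FORM OF THE SOURCE TILT: for ANY t-free finite law `Γ0` on ANY common space `Ω K` and ANY measurable projection
# `π : Ω K → GaugeField (F.P n) 0 G` onto a run's level-0 field space, the tilt `Γ0·e^{t·F_n∘π}` by the source of record is sandwiched with `M = e^{l₀}` — so module 20e's
# law∕tilt binders are discharged for EVERY reading whose t-dependence is the level-0 source factor (the multi-level kernel-tower reading included), and E1 of the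
# extraction clause follows from (RESUM) + the marginal identity `Γ0.map π = Boltzmann law`

Track A of `YM-PLAN.md` (cell `pub-ymgap`, HUMAN RULING D-0062), node **N21**; R134 fan-out seat `pub-ymgap-dag-n21-d` (s2 = BY-NAME KNIT at the record), generation 6,
module 23c.  THEOREMS ONLY: 0 `def`, 0 `sorry`, standard axioms; COUNT-NEUTRAL; `--supports` the K3⁗ item `SpineGivenEndpointR13Sep` (stmt-QuantumFields-20292) as a helper.
KEY-FREE (generic `D : FiniteEpsData F G`; no Stage-13 object), `N`- and `G`-generic, NO Theses import (restate-immune).  Imports module 23 `BalabanUVNodesN21SourceTiltAtRecord`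
(p502274: `dressedLaw_univ`, `measurable_ofReal_exp_source`; brings 20e `tilt_sandwich` ∕ `levelLedgers_histories_of_resummation` ∕ `shellWeightBound_histories_of_resummation` ∕
`sum_histWeight_eq_of_resummation`) and `T4GenFunConverse` (`schemeZ_pos`).

THE POINT.  Module 23b instantiated 20e's junction at ONE reading of the common space: the level-0 field spaces EMBEDDED into `Ω K` (the lens's model A).  The reading NODE O is more
likely to type is the KERNEL-TOWER one (dag-n19-d `…N19MGFKernelTower`: every class weight is an integral against a t-free finite measure obtained by transporting the start
density through def-T's T-step kernels): there the common space of run X is the JOINT multi-level configuration space, its t-free law `Γ0^X K` is the joint law (Boltzmann start ×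
kernels), and the source enters ONLY through the level-0 coordinate `π^X K : Ω K → GaugeField (F.P n) 0 G` as the factor `e^{t·F_n(π ω)}`.  For THAT shape nothing about `Γ0`
is needed for (TILT): `|F_n ∘ π| ≤ 1` pointwise (module 23 ∕ `FiniteEpsData.abs_avgObs_le_one`), so `Γ0·e^{t F_n∘π} ≤ e^{l₀} • Γ0` and `Γ0 ≤ e^{l₀} • Γ0·e^{t F_n∘π}` on `|t| ≤ l₀`
for EVERY measure `Γ0` (§1 `sourceTiltThrough_sandwich`).  Hence (§2) 20e's `levelLedgers_histories_of_resummation` ∕ `shellWeightBound_histories_of_resummation` with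
`γtX K t := (Γ0X K).withDensity (ofReal ∘ e^{t·F∘πX K})`, `M := e^{l₀}`: the binders `γtA γtB hM htiltA htiltB` are GONE, `γ0A := Γ0A`, `γ0B := Γ0B` stay NODE O's PARAMETERS
(any t-free finite laws on its common space), the projections `πA K`, `πB K` are PARAMETERS (measurable), and the caller supplies `D.AvgMeasurable`.  And (§3) E1: if in addition
the level-0 MARGINAL of run A's t-free law is the Boltzmann law of record — `(Γ0A K).map (πA K) = fieldMeasure.withDensity (ofReal ∘ boltzmann)` at step `K₀ + K` (for the
kernel-tower reading this is def-T's normalisation of the T-steps, [Balaban1989LargeFieldI] (0.4) `∫ρ_k = ∫ρ₀`, in the tree as `FiniteEpsData.integral_dens_eq_zero`; DISPLAYED here) —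
then (RESUM) gives `schemeZ (D.scheme g₀) os (K₀ + K) t = Σ_τ A_K(t, τ)` (`schemeZ_eq_sum_histWeight_of_resummation_through`).

HONEST FRAMING (binding).  [folklore] measure theory (`withDensity`, `Measure.map`, `lintegral_map`) on typed objects; the only fact about Bałaban's objects used is `|avgObs| ≤ 1`.
DISPLAYED after this file on the histories road: NODE O's common space `Ω`, t-free laws `Γ0X`, projections `πX`, history measures `νX`, statistics `uX`, index data (`T`, `small`, `C`,
`lvl`) and (RESUM) `Σ_τ histLaw^X_τ = Γ0X·e^{t F∘πX}` — the SHAPE of its term object (nothing of Bałaban's expansion is typed here); the marginal identity (for E1 only); N16's a.e.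
closeness by level, N20's window∕count, the admissible box, the rate, `AvgMeasurable`.  (M1) for print's FIXED thresholds untouched; NE7c is NOT PRINTED and NOT PROVED; **N21 is NOT
discharged**; K3⁗ NOT claimed; typed 28∕28, discharged count untouched; one finite four-torus programme at fixed `ε` — NOT ℝ⁴, NOT infinite volume, NOT OS, NOT a mass gap, NOT
Clay.  No decl below carries a cite tag.
-/

set_option autoImplicit false

noncomputable section

open scoped BigOperators ENNReal
open MeasureTheory Set

namespace Summit.QuantumFields.YangMills.Theorems.N21SourceTiltJointSpace

open Literature.MathematicalPhysics.QuantumFieldTheory.Balaban1983to89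
open Literature.MathematicalPhysics.QuantumFieldTheory.Balaban1983to89.T4Continuum (T4Family ULoop FiniteEpsData)
open T4GenFunBounds (prodObs schemeZ)
open Missing (boltzmann)
open T4IndicatorShell (ShellWeightBound)
open T4ShellMeasureLevels (LevelLedger LiveWindow)
open Summit.QuantumFields.BalabanUV.T4Continuum.ShellMeasureRootCompositionHistories (histWeight histShell histPiece histLaw)
open Summit.QuantumFields.YangMills.Theorems.N21SelectedThresholdsHistoriesResummation
  (tilt_sandwich levelLedgers_histories_of_resummation shellWeightBound_histories_of_resummation sum_histWeight_eq_of_resummation)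
open Summit.QuantumFields.YangMills.Theorems.N21SourceTiltAtRecord (dressedLaw_univ measurable_ofReal_exp_source)

/-! ## §1 (TILT) through a projection: any common space, any t-free law -/

section Through

variable {G : Type*} [GaugeGroup G] [MeasurableSpace G] [HaarData G] [RegularGaugeGroup G] {O : Type*}
  (S : Missing.TorusScheme G O) (n : ℕ) (os : List O) {Ω : Type*} [MeasurableSpace Ω]

omit [GaugeGroup G] [HaarData G] [RegularGaugeGroup G] in
/-- the source of record read through a measurable projection is measurable and bounded by one. [folklore] -/
theorem measurable_ofReal_exp_source_comp (hm : ∀ K o, Measurable (S.obs K o)) {π : Ω → GaugeField (S.P n) 0 G} (hπ : Measurable π) (t : ℝ) :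
    Measurable fun ω : Ω => ENNReal.ofReal (Real.exp (t * prodObs S n os (π ω))) :=
  (measurable_ofReal_exp_source S n os hm t).comp hπ

omit [GaugeGroup G] [HaarData G] [RegularGaugeGroup G] in
/-- **(TILT) THROUGH A PROJECTION, ANY COMMON SPACE, ANY t-FREE LAW**: for EVERY measure `Γ0` on `Ω` and every measurable `π : Ω → GaugeField (S.P n) 0 G`, the tilt of `Γ0` by the
source of record read at level 0, `e^{t·F_n(π ω)}` (`|F_n| ≤ 1`), satisfies `Γ0·e^{tF_n∘π} ≤ e^{l₀} • Γ0` and `Γ0 ≤ e^{l₀} • Γ0·e^{tF_n∘π}` on `|t| ≤ l₀` (20e `tilt_sandwich` at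
`F := F_n ∘ π`, `B_F = 1`).  This is the kernel-tower reading's (TILT): the joint multi-level law tilted through its level-0 coordinate. [folklore] -/
theorem sourceTiltThrough_sandwich (hm : ∀ K o, Measurable (S.obs K o)) (h1 : ∀ K o U, |S.obs K o U| ≤ 1) (Γ0 : Measure Ω)
    {π : Ω → GaugeField (S.P n) 0 G} (hπ : Measurable π) {l₀ t : ℝ} (ht : |t| ≤ l₀) :
    Γ0.withDensity (fun ω => ENNReal.ofReal (Real.exp (t * prodObs S n os (π ω)))) ≤ ENNReal.ofReal (Real.exp l₀) • Γ0 ∧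
    Γ0 ≤ ENNReal.ofReal (Real.exp l₀) • Γ0.withDensity (fun ω => ENNReal.ofReal (Real.exp (t * prodObs S n os (π ω)))) := by
  simpa only [mul_one] using
    tilt_sandwich Γ0 (F := fun ω => prodObs S n os (π ω)) ((T4GenFunBounds.measurable_prodObs S hm n os).comp hπ) (BF := 1)
      (fun ω => T4GenFunBounds.abs_prodObs_le_one S h1 n os (π ω)) ht

/-- **THE MASS OF THE TILT THROUGH A PROJECTION IS `Z_n(t)` WHEN THE LEVEL-0 MARGINAL IS THE BOLTZMANN LAW**: if `Γ0.map π = dU·ofReal(e^{−βA})`, then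
`(Γ0·e^{tF_n∘π})(Ω) = ofReal (schemeZ S os n t)` (`lintegral_map` + module 23 `dressedLaw_univ` through `dressedLaw_eq_withDensity_boltzmannLaw`). [folklore] -/
theorem tiltThrough_univ_of_marginal (hβ : ∀ K, 0 ≤ S.β K) (hm : ∀ K o, Measurable (S.obs K o)) (h1 : ∀ K o U, |S.obs K o U| ≤ 1) (Γ0 : Measure Ω)
    {π : Ω → GaugeField (S.P n) 0 G} (hπ : Measurable π)
    (hmarg : Γ0.map π = (fieldMeasure (S.P n) 0 G).withDensity (fun U => ENNReal.ofReal (boltzmann (S.P n) (S.β n) U))) (t : ℝ) :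
    Γ0.withDensity (fun ω => ENNReal.ofReal (Real.exp (t * prodObs S n os (π ω)))) univ = ENNReal.ofReal (schemeZ S os n t) := by
  rw [withDensity_apply _ MeasurableSet.univ, Measure.restrict_univ, ← lintegral_map (measurable_ofReal_exp_source S n os hm t) hπ, hmarg,
    ← setLIntegral_univ, ← withDensity_apply _ MeasurableSet.univ,
    ← N21SourceTiltAtRecord.dressedLaw_eq_withDensity_boltzmannLaw S n os hm t, dressedLaw_univ S n os hβ hm h1 t]

end Through

/-! ## §2 Module 20e's junction with the tilt read through the level-0 projections of NODE O's common space -/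

section Junction

variable {F : T4Family} {G : Type*} [GaugeGroup G] [MeasurableSpace G] [HaarData G] [RegularGaugeGroup G]
  (D : FiniteEpsData F G) (g₀ : ℕ → ℝ) (os : List (ULoop F)) (K₀ : ℕ)
  {Ω : ℕ → Type*} [∀ K, MeasurableSpace (Ω K)] {σ ι : Type*} [DecidableEq σ]
  {T : ℕ → Finset ι} {C : ℕ → Finset σ} {small : ℕ → ι → Finset σ} {lvl : ℕ → σ → ℕ}
  {νA νB : ∀ K : ℕ, (ℕ → ℝ) → ℝ → ι → Measure (Ω K)} [∀ K a t τ, IsFiniteMeasure (νA K a t τ)] [∀ K a t τ, IsFiniteMeasure (νB K a t τ)]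
  {Γ0A Γ0B : ∀ K : ℕ, Measure (Ω K)} [∀ K, IsFiniteMeasure (Γ0A K)] [∀ K, IsFiniteMeasure (Γ0B K)]
  {πA : ∀ K : ℕ, Ω K → GaugeField ((D.scheme g₀).P (K₀ + K)) 0 G} {πB : ∀ K : ℕ, Ω K → GaugeField ((D.scheme g₀).P (K₀ + K + 1)) 0 G}
  {uA uB : ∀ K : ℕ, σ → Ω K → ℝ} {θ κ ρ Δ : ℕ → ℝ} {l₀ νbar : ℝ}

omit [DecidableEq σ] [∀ K a t τ, IsFiniteMeasure (νB K a t τ)] [∀ K, IsFiniteMeasure (Γ0A K)] [∀ K, IsFiniteMeasure (Γ0B K)] in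
/-- **E1 FROM (RESUM) THROUGH THE PROJECTION, GIVEN THE MARGINAL IDENTITY**: if run A's history laws at `(K, a, t)` resum to `Γ0A K·e^{t F∘πA K}` and the level-0 marginal of
`Γ0A K` is the Boltzmann law of record at step `K₀ + K` (for the kernel-tower reading: the T-steps' normalisation, (0.4)), then `schemeZ (D.scheme g₀) os (K₀ + K) t = Σ_τ A_K(t, τ)`
— the extraction clause's E1 for the history weights. [folklore] -/
theorem schemeZ_eq_sum_histWeight_of_resummation_through (hM : D.AvgMeasurable) (hπA : ∀ K, Measurable (πA K))
    (hmargA : ∀ K, (Γ0A K).map (πA K) = (fieldMeasure ((D.scheme g₀).P (K₀ + K)) 0 G).withDensity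
      (fun U => ENNReal.ofReal (boltzmann ((D.scheme g₀).P (K₀ + K)) ((D.scheme g₀).β (K₀ + K)) U)))
    (huA : ∀ K s, Measurable (uA K s)) (K : ℕ) (a : ℕ → ℝ) (t : ℝ)
    (hres : ∑ τ ∈ T K, histLaw (νA K a t τ) (small K τ) (uA K) (fun s => a (lvl K s)) =
      (Γ0A K).withDensity (fun ω => ENNReal.ofReal (Real.exp (t * prodObs (D.scheme g₀) (K₀ + K) os (πA K ω))))) :
    schemeZ (D.scheme g₀) os (K₀ + K) t = ∑ τ ∈ T K, histWeight (νA K a t τ) (small K τ) (uA K) (fun s => a (lvl K s)) := by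
  have hm : ∀ K C, Measurable ((D.scheme g₀).obs K C) := fun K C => D.measurable_avgObs hM K C
  have h1 : ∀ K C U, |(D.scheme g₀).obs K C U| ≤ 1 := fun K C U => D.abs_avgObs_le_one K C U
  rw [sum_histWeight_eq_of_resummation (T K) (νA K a t) (small K) (huA K) _ hres,
    tiltThrough_univ_of_marginal (D.scheme g₀) (K₀ + K) os (fun _ => sq_nonneg _) hm h1 (Γ0A K) (hπA K) (hmargA K) t,
    ENNReal.toReal_ofReal (T4GenFunConverse.schemeZ_pos (D.scheme g₀) (fun _ => sq_nonneg _) hm h1 (K₀ + K) os t).le]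

/-- **BOTH RUNS' HISTORY LEDGERS AT THE SAME SELECTED THRESHOLDS, RESUMMED AGAINST NODE O's t-FREE LAWS TILTED THROUGH THE LEVEL-0 PROJECTIONS** — module 20e's
`levelLedgers_histories_of_resummation` with `γ0X := Γ0X` (PARAMETERS: any t-free finite laws on the common space), `γtX K t := (Γ0X K)·e^{t·F∘πX K}`, `M := e^{l₀}`: the binders
`γtA γtB hM htiltA htiltB` are GONE (§1), for ANY measurable projections `πA K : Ω K → GaugeField (F.P (K₀+K)) 0 G`, `πB K : Ω K → GaugeField (F.P (K₀+K+1)) 0 G`.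
`D_j = (e^{l₀}∕(e^{l₀})⁻¹)·2ν̄∕((1−ρ_j)κ_j)`. [folklore] -/
theorem levelLedgers_histories_of_resummation_through (hM : D.AvgMeasurable) (hπA : ∀ K, Measurable (πA K)) (hπB : ∀ K, Measurable (πB K))
    (huA : ∀ K s, Measurable (uA K s)) (huB : ∀ K s, Measurable (uB K s))
    (hsmall : ∀ K, ∀ τ ∈ T K, small K τ ⊆ C K)
    (hθ : ∀ j, 0 < θ j) (hκ : ∀ j, 0 < κ j ∧ κ j ≤ 1) (hρ : ∀ j, 0 ≤ ρ j ∧ ρ j < 1)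
    (hcount : ∀ K m, ((((C K).filter fun s => lvl K s = m).card : ℕ) : ℝ) ≤ νbar)
    (hle : ∀ K, ∀ s ∈ C K, lvl K s ≤ K)
    (hΔ : ∀ j, Δ j ≤ ρ j * ((1 - κ j) * θ j))
    (hcloseA : ∀ (K : ℕ) (a : ℕ → ℝ), (∀ j, a j ∈ Icc ((1 - κ j) * θ j) (θ j)) → ∀ t, |t| ≤ l₀ → ∀ τ ∈ T K, ∀ s ∈ small K τ,
      ∀ᵐ ω ∂(νA K a t τ), |uA K s ω - uB K s ω| ≤ Δ (lvl K s))
    (hcloseB : ∀ (K : ℕ) (a : ℕ → ℝ), (∀ j, a j ∈ Icc ((1 - κ j) * θ j) (θ j)) → ∀ t, |t| ≤ l₀ → ∀ τ ∈ T K, ∀ s ∈ small K τ,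
      ∀ᵐ ω ∂(νB K a t τ), |uB K s ω - uA K s ω| ≤ Δ (lvl K s))
    (hresA : ∀ (K : ℕ) (a : ℕ → ℝ), (∀ j, a j ∈ Icc ((1 - κ j) * θ j) (θ j)) → ∀ t, |t| ≤ l₀ →
      ∑ τ ∈ T K, histLaw (νA K a t τ) (small K τ) (uA K) (fun s => a (lvl K s)) =
        (Γ0A K).withDensity (fun ω => ENNReal.ofReal (Real.exp (t * prodObs (D.scheme g₀) (K₀ + K) os (πA K ω)))))
    (hresB : ∀ (K : ℕ) (a : ℕ → ℝ), (∀ j, a j ∈ Icc ((1 - κ j) * θ j) (θ j)) → ∀ t, |t| ≤ l₀ →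
      ∑ τ ∈ T K, histLaw (νB K a t τ) (small K τ) (uB K) (fun s => a (lvl K s)) =
        (Γ0B K).withDensity (fun ω => ENNReal.ofReal (Real.exp (t * prodObs (D.scheme g₀) (K₀ + K + 1) os (πB K ω))))) :
    ∃ a : ℕ → ℕ → ℝ, (∀ K j, a K j ∈ Icc ((1 - κ j) * θ j) (θ j)) ∧
      LevelLedger l₀ T (fun K t τ => histWeight (νA K (a K) t τ) (small K τ) (uA K) (fun s => a K (lvl K s)))
        (fun K t τ => histShell (νA K (a K) t τ) (small K τ) (uA K) (uB K) (fun s => a K (lvl K s))) C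
        (fun K t s τ => histPiece (νA K (a K) t τ) (small K τ) (uA K) (uB K) (fun s => a K (lvl K s)) s) lvl
        (fun j => Real.exp l₀ / (Real.exp l₀)⁻¹ * (2 * νbar / ((1 - ρ j) * κ j))) ρ ∧
      LevelLedger l₀ T (fun K t τ => histWeight (νB K (a K) t τ) (small K τ) (uB K) (fun s => a K (lvl K s)))
        (fun K t τ => histShell (νB K (a K) t τ) (small K τ) (uB K) (uA K) (fun s => a K (lvl K s))) C
        (fun K t s τ => histPiece (νB K (a K) t τ) (small K τ) (uB K) (uA K) (fun s => a K (lvl K s)) s) lvl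
        (fun j => Real.exp l₀ / (Real.exp l₀)⁻¹ * (2 * νbar / ((1 - ρ j) * κ j))) ρ := by
  have hm : ∀ K C, Measurable ((D.scheme g₀).obs K C) := fun K C => D.measurable_avgObs hM K C
  have h1 : ∀ K C U, |(D.scheme g₀).obs K C U| ≤ 1 := fun K C U => D.abs_avgObs_le_one K C U
  exact levelLedgers_histories_of_resummation
    (γtA := fun K t => (Γ0A K).withDensity (fun ω => ENNReal.ofReal (Real.exp (t * prodObs (D.scheme g₀) (K₀ + K) os (πA K ω)))))
    (γtB := fun K t => (Γ0B K).withDensity (fun ω => ENNReal.ofReal (Real.exp (t * prodObs (D.scheme g₀) (K₀ + K + 1) os (πB K ω)))))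
    (M := Real.exp l₀)
    huA huB hsmall hθ hκ hρ hcount hle (Real.exp_pos l₀) hΔ hcloseA hcloseB
    (fun K t ht => sourceTiltThrough_sandwich (D.scheme g₀) (K₀ + K) os hm h1 (Γ0A K) (hπA K) ht)
    (fun K t ht => sourceTiltThrough_sandwich (D.scheme g₀) (K₀ + K + 1) os hm h1 (Γ0B K) (hπB K) ht)
    hresA hresB

/-- **N21's ROAD I ON HISTORY FAMILIES AT SELECTED THRESHOLDS, RESUMMED AGAINST NODE O's t-FREE LAWS TILTED THROUGH THE LEVEL-0 PROJECTIONS** — module 20e's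
`shellWeightBound_histories_of_resummation` with the five binders instantiated as in `levelLedgers_histories_of_resummation_through`: for SOME assignment admissible at every level,
`ShellWeightBound l₀ T A B shA shB (K ↦ C′·ϑ^K)`, `C′ = 2((N₁+1)·ν̄·(e^{l₀}∕(e^{l₀})⁻¹·(4ν̄∕κ_min))·c₁·ϑ^{−N₁})`. [folklore] -/
theorem shellWeightBound_histories_of_resummation_through {N₁ : ℕ} {κmin c₁ ϑ : ℝ} (hM : D.AvgMeasurable)
    (hπA : ∀ K, Measurable (πA K)) (hπB : ∀ K, Measurable (πB K))
    (huA : ∀ K s, Measurable (uA K s)) (huB : ∀ K s, Measurable (uB K s))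
    (hsmall : ∀ K, ∀ τ ∈ T K, small K τ ⊆ C K)
    (hθ : ∀ j, 0 < θ j) (hκ : ∀ j, 0 < κ j ∧ κ j ≤ 1) (hρ : ∀ j, 0 ≤ ρ j ∧ ρ j < 1)
    (hwin : LiveWindow C lvl N₁ νbar)
    (hΔ : ∀ j, Δ j ≤ ρ j * ((1 - κ j) * θ j))
    (hcloseA : ∀ (K : ℕ) (a : ℕ → ℝ), (∀ j, a j ∈ Icc ((1 - κ j) * θ j) (θ j)) → ∀ t, |t| ≤ l₀ → ∀ τ ∈ T K, ∀ s ∈ small K τ,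
      ∀ᵐ ω ∂(νA K a t τ), |uA K s ω - uB K s ω| ≤ Δ (lvl K s))
    (hcloseB : ∀ (K : ℕ) (a : ℕ → ℝ), (∀ j, a j ∈ Icc ((1 - κ j) * θ j) (θ j)) → ∀ t, |t| ≤ l₀ → ∀ τ ∈ T K, ∀ s ∈ small K τ,
      ∀ᵐ ω ∂(νB K a t τ), |uB K s ω - uA K s ω| ≤ Δ (lvl K s))
    (hresA : ∀ (K : ℕ) (a : ℕ → ℝ), (∀ j, a j ∈ Icc ((1 - κ j) * θ j) (θ j)) → ∀ t, |t| ≤ l₀ →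
      ∑ τ ∈ T K, histLaw (νA K a t τ) (small K τ) (uA K) (fun s => a (lvl K s)) =
        (Γ0A K).withDensity (fun ω => ENNReal.ofReal (Real.exp (t * prodObs (D.scheme g₀) (K₀ + K) os (πA K ω)))))
    (hresB : ∀ (K : ℕ) (a : ℕ → ℝ), (∀ j, a j ∈ Icc ((1 - κ j) * θ j) (θ j)) → ∀ t, |t| ≤ l₀ →
      ∑ τ ∈ T K, histLaw (νB K a t τ) (small K τ) (uB K) (fun s => a (lvl K s)) =
        (Γ0B K).withDensity (fun ω => ENNReal.ofReal (Real.exp (t * prodObs (D.scheme g₀) (K₀ + K + 1) os (πB K ω)))))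
    (hκmin : 0 < κmin) (hκminle : ∀ j, κmin ≤ κ j) (hρhalf : ∀ j, ρ j ≤ 1 / 2)
    (hϑ0 : 0 < ϑ) (hϑ1 : ϑ < 1) (hrate : ∀ j, ρ j ≤ c₁ * ϑ ^ j) :
    ∃ a : ℕ → ℕ → ℝ, (∀ K j, a K j ∈ Icc ((1 - κ j) * θ j) (θ j)) ∧
      ShellWeightBound l₀ T (fun K t τ => histWeight (νA K (a K) t τ) (small K τ) (uA K) (fun s => a K (lvl K s)))
        (fun K t τ => histWeight (νB K (a K) t τ) (small K τ) (uB K) (fun s => a K (lvl K s)))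
        (fun K t τ => histShell (νA K (a K) t τ) (small K τ) (uA K) (uB K) (fun s => a K (lvl K s)))
        (fun K t τ => histShell (νB K (a K) t τ) (small K τ) (uB K) (uA K) (fun s => a K (lvl K s)))
        fun K => (2 * ((N₁ + 1) * νbar * (Real.exp l₀ / (Real.exp l₀)⁻¹ * (2 * (2 * νbar) / κmin)) * c₁ * ϑ⁻¹ ^ N₁)) * ϑ ^ K := by
  have hm : ∀ K C, Measurable ((D.scheme g₀).obs K C) := fun K C => D.measurable_avgObs hM K C
  have h1 : ∀ K C U, |(D.scheme g₀).obs K C U| ≤ 1 := fun K C U => D.abs_avgObs_le_one K C U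
  exact shellWeightBound_histories_of_resummation
    (γtA := fun K t => (Γ0A K).withDensity (fun ω => ENNReal.ofReal (Real.exp (t * prodObs (D.scheme g₀) (K₀ + K) os (πA K ω)))))
    (γtB := fun K t => (Γ0B K).withDensity (fun ω => ENNReal.ofReal (Real.exp (t * prodObs (D.scheme g₀) (K₀ + K + 1) os (πB K ω)))))
    (M := Real.exp l₀)
    huA huB hsmall hθ hκ hρ hwin (Real.exp_pos l₀) hΔ hcloseA hcloseB
    (fun K t ht => sourceTiltThrough_sandwich (D.scheme g₀) (K₀ + K) os hm h1 (Γ0A K) (hπA K) ht)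
    (fun K t ht => sourceTiltThrough_sandwich (D.scheme g₀) (K₀ + K + 1) os hm h1 (Γ0B K) (hπB K) ht)
    hresA hresB hκmin hκminle hρhalf hϑ0 hϑ1 hrate

end Junction

end Summit.QuantumFields.YangMills.Theorems.N21SourceTiltJointSpace

end
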